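import Summits.ResolutionOfSingularities.ResolutionOfSingularities.Theorems.FrobeniusLadderFInjectiveMacaulayficationDegreeZeroDescentLocal
import Summits.ResolutionOfSingularities.ResolutionOfSingularities.Theorems.FrobeniusLadderFInjectiveMacaulayficationDeformation
import HarnessLib

/-!
# Deformation then degree-zero descent: the card's Proposition in abstract chart form (E1 ∘ E4)

Support file for crux stmt-ResolutionOfSingularities-15315 (`FrobeniusLadder.FInjectiveMacaulayfication`,
line `Sketch`, lead seat c3, cycle 4). Card `weighted-cone-deformation-descent` certifies a (weighted) blow-up
chart `Spec T₀`, `T₀ ⊆ T` the degree-zero part of a localized Rees algebra, in two moves: (i) DEFORMATION — in the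
local rings `T_Q` the element `t⁻¹` is a non-zero-divisor with `T_Q/t⁻¹T_Q` a local ring of the (localized)
associated graded ring, so the clause for `T_Q/t⁻¹` gives it for `T_Q` (E1, `Deformation.cmfi_of_cmfi_quotient`,
p132502, Fedder 1983 Thm 3.4(1)); (ii) DEGREE-ZERO DESCENT — the clause passes from the `T_Q` to `(T₀)_n` along the
degree-zero retraction (E4, `DegreeZeroDescent.inlineClause_localization_of_retract`, p135117).

`inlineClause_localization_of_deformation` is the composite, for an arbitrary algebra `A → B` of Noetherian rings
with an `A`-linear retraction `ρ` (`A` of characteristic `p`), a non-zero-divisor `τ ∈ B` ("`t⁻¹`") and a prime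
`n` of `A`: if for every system of parameters `s` of `A_n` and every prime `Q` of `B` maximal over `n` (induced map
`ψ : A_n → B_Q`) EITHER all `ψ(sᵢ)` are non-units and then `τ ∈ Q`, the quotient `B_Q/(τ)` satisfies the clause,
and `dim B_Q = d + e`, `dim B_Q/(ψ s) = e`, OR some `ψ(sᵢ)` is a unit and the `ψ(sᵢ)` are still weakly regular —
then `A_n` satisfies the crux's per-stalk clause. No associated-graded object is needed to STATE it: in the
intended instance `B = A'_f` (`A'` the Rees algebra of a filtration, `f = a tᵏ`) one has `τ = a t^{k-1}/f` and
`B_Q/(τ)` IS the localized associated graded ring; the hypothesis "punctured `Spec gr` is CM + F-injective" is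
exactly the clause for these quotients. What remains for a line adopting the card: the Rees algebra of a
filtration with its grading (Mathlib `reesAlgebra` + the tree's `reesGrading` in the `I`-adic case), the
retraction for `T₀ = HomogeneousLocalization.Away 𝒜 f ⊆ Localization.Away f` (stub `stub_awayDegreeZeroRetract`),
and the dimension bookkeeping.
-/

-- single-problem summit: the doubled namespace component is forced
set_option linter.dupNamespace false

namespace Summit.ResolutionOfSingularities.ResolutionOfSingularities.Theorems.FInjectiveMacaulayfication.DeformationDescent

open IsLocalRing RingTheory.Sequence Literature.RingTheory.TightClosure

variable (p : ℕ) [Fact p.Prime]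

/-- **DEFORMATION ∘ DEGREE-ZERO DESCENT** (card `weighted-cone-deformation-descent`, Proposition, abstract chart
form): see the module docstring. The per-`Q` hypothesis in the "all `ψ(sᵢ)` non-units" case is: `τ ∈ Q`, the
crux's clause (inline) for `B_Q ⧸ (τ)`, and the dimension data; E1 turns it into the clause for `B_Q`, and E4
descends to `A_n`. [folklore; Fedder1983 Thm 3.4(1) + cf. card step (ii)] -/
theorem inlineClause_localization_of_deformation {A B : Type} [CommRing A] [CommRing B] [IsNoetherianRing A]
    [IsNoetherianRing B] [CharP A p] [Algebra A B] (ρ : B →ₗ[A] A) (hρ : ρ 1 = 1)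
    (τ : B) (hτ : τ ∈ nonZeroDivisors B) (n : Ideal A) [n.IsPrime]
    (h : ∀ (d : ℕ) (s : Fin d → Localization.AtPrime n), IsSystemOfParameters s →
      ∀ (Q : Ideal B) [Q.IsPrime], Q.comap (algebraMap A B) ≤ n →
        (∀ Q' : Ideal B, Q'.IsPrime → Q ≤ Q' → Q'.comap (algebraMap A B) ≤ n → Q' ≤ Q) →
        ∀ ψ : Localization.AtPrime n →+* Localization.AtPrime Q,
          ψ.comp (algebraMap A (Localization.AtPrime n)) =
            (algebraMap B (Localization.AtPrime Q)).comp (algebraMap A B) →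
          ((∀ i, ψ (s i) ∈ maximalIdeal (Localization.AtPrime Q)) →
            τ ∈ Q ∧
            (∀ m : ℕ, ringKrullDim (Localization.AtPrime Q ⧸
                Ideal.span {algebraMap B (Localization.AtPrime Q) τ}) = m →
              ∀ u : Fin m → Localization.AtPrime Q ⧸ Ideal.span {algebraMap B (Localization.AtPrime Q) τ},
                (Ideal.span (Set.range u)).radical.IsMaximal →
                IsWeaklyRegular (Localization.AtPrime Q ⧸ Ideal.span {algebraMap B (Localization.AtPrime Q) τ})
                  (List.ofFn u) ∧
                ∀ y : Localization.AtPrime Q ⧸ Ideal.span {algebraMap B (Localization.AtPrime Q) τ},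
                  (∃ e : ℕ, y ^ p ^ e ∈ Ideal.span
                    ((fun z : Localization.AtPrime Q ⧸ Ideal.span {algebraMap B (Localization.AtPrime Q) τ} =>
                      z ^ p ^ e) '' (Ideal.span (Set.range u) :
                        Set (Localization.AtPrime Q ⧸ Ideal.span {algebraMap B (Localization.AtPrime Q) τ})))) →
                  y ∈ Ideal.span (Set.range u)) ∧
            ∃ e : ℕ, ringKrullDim (Localization.AtPrime Q) = ((d + e : ℕ) : WithBot ℕ∞) ∧
              ringKrullDim (Localization.AtPrime Q ⧸ Ideal.span (Set.range fun i => ψ (s i))) =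
                (e : WithBot ℕ∞)) ∧
          ((∃ i, ψ (s i) ∉ maximalIdeal (Localization.AtPrime Q)) →
            IsWeaklyRegular (Localization.AtPrime Q) (List.ofFn fun i => ψ (s i)))) :
    ∀ d : ℕ, ringKrullDim (Localization.AtPrime n) = d → ∀ s : Fin d → Localization.AtPrime n,
      (Ideal.span (Set.range s)).radical.IsMaximal →
      IsWeaklyRegular (Localization.AtPrime n) (List.ofFn s) ∧
      ∀ y : Localization.AtPrime n, (∃ e : ℕ, y ^ p ^ e ∈ Ideal.span
        ((fun z : Localization.AtPrime n => z ^ p ^ e) ''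
          (Ideal.span (Set.range s) : Set (Localization.AtPrime n)))) → y ∈ Ideal.span (Set.range s) := by
  haveI : CharP B p :=
    charP_of_injective_algebraMap (DegreeZeroDescent.algebraMap_injective_of_retract ρ hρ) p
  refine DegreeZeroDescent.inlineClause_localization_of_retract p ρ hρ n
    fun d s hs Q _ hQn hQmax ψ hψ => ?_
  obtain ⟨hgood, hoff⟩ := h d s hs Q hQn hQmax ψ hψ
  refine ⟨fun hall => ?_, hoff⟩
  obtain ⟨hτQ, hquot, e, hdim, hq⟩ := hgood hall
  haveI : CharP (Localization.AtPrime Q) p := DegreeZeroDescent.charP_localization_atPrime p Q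
  have hx : algebraMap B (Localization.AtPrime Q) τ ∈ maximalIdeal (Localization.AtPrime Q) :=
    (IsLocalization.AtPrime.to_map_mem_maximal_iff (Localization.AtPrime Q) Q τ).mpr hτQ
  have hx0 : algebraMap B (Localization.AtPrime Q) τ ∈ nonZeroDivisors (Localization.AtPrime Q) :=
    IsLocalization.nonZeroDivisors_le_comap Q.primeCompl (Localization.AtPrime Q) hτ
  exact ⟨Deformation.cmfi_of_cmfi_quotient p (Localization.AtPrime Q) _ hx hx0 hquot, e, hdim, hq⟩

/-! ## Registered form -/

/-- **E1 ∘ E4, registered helper-stub form** (fully explicit binders; = `inlineClause_localization_of_deformation`).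
[folklore; Fedder1983 Thm 3.4(1) + cf. card weighted-cone-deformation-descent] -/
theorem stub_deformationDescent : ∀ (p : ℕ) [Fact p.Prime] (A B : Type) [CommRing A] [CommRing B] [IsNoetherianRing A]
    [IsNoetherianRing B] [CharP A p] [Algebra A B] (ρ : B →ₗ[A] A), ρ 1 = 1 →
    ∀ (τ : B), τ ∈ nonZeroDivisors B → ∀ (n : Ideal A) [n.IsPrime],
    (∀ (d : ℕ) (s : Fin d → Localization.AtPrime n), Literature.RingTheory.TightClosure.IsSystemOfParameters s →
      ∀ (Q : Ideal B) [Q.IsPrime], Q.comap (algebraMap A B) ≤ n →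
        (∀ Q' : Ideal B, Q'.IsPrime → Q ≤ Q' → Q'.comap (algebraMap A B) ≤ n → Q' ≤ Q) →
        ∀ ψ : Localization.AtPrime n →+* Localization.AtPrime Q,
          ψ.comp (algebraMap A (Localization.AtPrime n)) =
            (algebraMap B (Localization.AtPrime Q)).comp (algebraMap A B) →
          ((∀ i, ψ (s i) ∈ IsLocalRing.maximalIdeal (Localization.AtPrime Q)) →
            τ ∈ Q ∧
            (∀ m : ℕ, ringKrullDim (Localization.AtPrime Q ⧸
                Ideal.span {algebraMap B (Localization.AtPrime Q) τ}) = m →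
              ∀ u : Fin m → Localization.AtPrime Q ⧸ Ideal.span {algebraMap B (Localization.AtPrime Q) τ},
                (Ideal.span (Set.range u)).radical.IsMaximal →
                RingTheory.Sequence.IsWeaklyRegular
                  (Localization.AtPrime Q ⧸ Ideal.span {algebraMap B (Localization.AtPrime Q) τ}) (List.ofFn u) ∧
                ∀ y : Localization.AtPrime Q ⧸ Ideal.span {algebraMap B (Localization.AtPrime Q) τ},
                  (∃ e : ℕ, y ^ p ^ e ∈ Ideal.span
                    ((fun z : Localization.AtPrime Q ⧸ Ideal.span {algebraMap B (Localization.AtPrime Q) τ} =>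
                      z ^ p ^ e) '' (Ideal.span (Set.range u) :
                        Set (Localization.AtPrime Q ⧸ Ideal.span {algebraMap B (Localization.AtPrime Q) τ})))) →
                  y ∈ Ideal.span (Set.range u)) ∧
            ∃ e : ℕ, ringKrullDim (Localization.AtPrime Q) = ((d + e : ℕ) : WithBot ℕ∞) ∧
              ringKrullDim (Localization.AtPrime Q ⧸ Ideal.span (Set.range fun i => ψ (s i))) =
                (e : WithBot ℕ∞)) ∧
          ((∃ i, ψ (s i) ∉ IsLocalRing.maximalIdeal (Localization.AtPrime Q)) →
            RingTheory.Sequence.IsWeaklyRegular (Localization.AtPrime Q) (List.ofFn fun i => ψ (s i)))) →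
    ∀ d : ℕ, ringKrullDim (Localization.AtPrime n) = d → ∀ s : Fin d → Localization.AtPrime n,
      (Ideal.span (Set.range s)).radical.IsMaximal →
      RingTheory.Sequence.IsWeaklyRegular (Localization.AtPrime n) (List.ofFn s) ∧
      ∀ y : Localization.AtPrime n, (∃ e : ℕ, y ^ p ^ e ∈ Ideal.span
        ((fun z : Localization.AtPrime n => z ^ p ^ e) ''
          (Ideal.span (Set.range s) : Set (Localization.AtPrime n)))) → y ∈ Ideal.span (Set.range s) :=
  fun p _ _ _ _ _ _ _ _ _ ρ hρ τ hτ n _ h => inlineClause_localization_of_deformation p ρ hρ τ hτ n h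

end Summit.ResolutionOfSingularities.ResolutionOfSingularities.Theorems.FInjectiveMacaulayfication.DeformationDescent
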